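import Summits.HodgeConjecture.HodgeConjecture.Theorems.Ring2WeilCoverageLatticeNormTwist
import Summits.HodgeConjecture.HodgeConjecture.Theorems.Ring2WeilCoverageCyclotomicTwistedLevelsIff
import Summits.HodgeConjecture.HodgeConjecture.Theorems.Ring2WeilCoverageCyclotomicUnitProducts
import HarnessLib

/-!
# Weil-type family coverage — level `M = 56`, the NON-PRINCIPAL lattice class: the prime `𝔓 = (1 − ζ⁷, ζ⁸ + ζ¹⁶ + ζ³²)` over
# `2` has `𝔓𝔓^ρ = (α)`, `α = ζ²⁴(1 − ζ)(1 − ζ⁶³) ∈ ℚ(ζ₅₆)⁺` negative at exactly THREE places of each `χ₈`-class, so the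
# verdict FLIPS: `ℂ^Φ/Φ(𝔓)` is principally polarisable iff both twisted counts are ODD — and `𝔓` is not principal

research route conditional on HC_CM; not a corollary; Q11.4-sentence-2 already refuted in dim ≥ 3.

Ring 2, WEIL-TYPE FAMILY-COVERAGE CENSUS (`HOME/WEIL-FAMILY-COVERAGE.md` `## b01`, block b01.39 (F) «NOT CLAIMED: the non-principal
lattice class at `39/56`», owner ring2-b01), part 44 of the `Ring2WeilCoverage*` series — the level-`56` twin of part 43.
`h(ℚ(ζ₅₆)) = 2`: besides `ℂ^Φ/Φ(ℤ[ζ₅₆])` (parts 37/39/41) every simple CM abelian variety with CM by `ℤ[ζ₅₆]` and type `Φ` is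
`ℂ^Φ/Φ(𝔪)` for ONE more lattice class; this file decides it, hypothesis-free, with the twist principle of part 42:

* §1 the element `α = ζ²⁴(1 − ζ)(1 − ζ⁶³)` (part 13's normalisation `2h + a + b = 112`): `σ_t(α) = −4 sin(πt/56) sin(63πt/56)`
  is real, non-zero, NEGATIVE iff `56 < t mod 112 ↔ 56 < 63t mod 112` (`alpha_read`), i.e. iff
  `t ∈ A = {9,11,13,15,25,27,29,31,41,43,45,47}`; `α^ρ = α ≠ 0`.
* §2 `card_filter_negA_plus/_minus`: every CM-type set meets `A ∩ C₊ = {9,15,25,31,41,47}` and `A ∩ C₋ = {11,13,27,29,43,45}`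
  in exactly `3` residues (part 42 `two_mul_card_inter_eq`).
* §3 **`principal_iff_odd_of_mul_conjIdeal_eq` (THE FLIPPED LAW)**: for ANY lattice `𝔪` with `𝔪𝔪^ρ = (α)` and any CM type
  `Φ`: `ℂ^Φ/D(𝔪)` carries an `ι`-compatible principal polarisation **iff `|S_Φ ∩ C₊ ∩ N_odd|` and `|S_Φ ∩ C₋ ∩ N_odd|` are
  both ODD** (`C₊ = {χ₈ = +1}`) — part 41's `principal_iff_fiftySix` for the twisted type `Φ_α`.
* §4 the lattice: `𝔓 = (1 − ζ⁷, θ) ⊂ 𝓞 K`, `θ = ζ⁸ + ζ¹⁶ + ζ³²` (a Gauss period of `ℚ(√−7) ⊂ ℚ(ζ⁸) = ℚ(ζ₇)`, `θθ̄ = 2`: a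
  prime over `2`), `𝔓^ρ = (1 − ζ⁴⁹, ζ²⁴ + ζ⁴⁰ + ζ⁴⁸)`, **`𝔓𝔓^ρ = (α)`** (`span_mul_map_conj_eq`: four explicit quotients in
  `ℤ[ζ]` and `α = −ζ²⁴(1−ζ)·(1−ζ⁷)θ̄ + ζ³¹(1−ζ)·θ(1−ζ⁴⁹)`, all `linear_combination` mod `Φ₅₆`); so
  **`principal_iff_odd_fiftySix_nonprincipal`**: the flipped law on `ℂ^Φ/Φ(𝔓)`; and **`not_isPrincipal_fiftySix`: `𝔓` is NOT
  principal** (at `S_Φ = N_odd` the verdicts of `ℤ[ζ₅₆]` and `𝔓` differ; part 42 §4).  (`h(ℚ(ζ₅₆)) > 1` in the kernel.)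
* §5 `exists_principal_on_some_lattice_fiftySix`: every CM type whose two twisted counts have the same parity — in particular
  every `K`-balanced `Φ` of the four census rows `(56, ℚ(i)), (56, ℚ(√−2)), (56, ℚ(√−7)), (56, ℚ(√−14))` (b01.39 (D)) — is
  principally polarisable on `ℤ[ζ₅₆]` or on `𝔓`: the census's NO classes there are NO on `ℤ[ζ₅₆]` and YES on `𝔓`.

HONEST FRAMING: statements about Shimura's divisors of principal type on the principal CM tori `ℂ^Φ/D(𝔪)`, `𝔪𝔪^ρ = (α)`;
that `{ℤ[ζ₅₆], 𝔓}` exhausts the lattice classes is `h(ℚ(ζ₅₆)) = 2` [Washington1997, tables §11] and is NOT proved here (only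
`[𝔓] ≠ 1`); nothing about Hodge classes, `W_K`, general members or HC; `HC_CM` is used nowhere.  No `def`, no named fact,
no `sorry`.  References: [cite: Shimura1998, §14.3 Prop. 4–5, pp. 103–104; §14.4 Prop. 7, p. 105]; [cite: Washington1997,
§8.1, Prop. 2.8, tables §11 (h(ℚ(ζ₅₆)) = 2)]; census b01.25 (A), b01.39 (seat-derived); certificates `g60/py/cert_np56.py`.
-/

noncomputable section

open Polynomial NumberField NumberField.ComplexEmbedding Complex Finset FractionalIdeal
open scoped nonZeroDivisors Real

namespace Summit.HodgeConjecture.Ring2WeilCoverage.NonPrincipalLatticeLevel56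

open Literature.AlgebraicGeometry.Motives (CMType)
open Literature.AlgebraicGeometry.HodgeTheory (IsCMTypeSet)
open Literature.AlgebraicGeometry.ComplexMultiplication.CyclotomicCMType
open Literature.NumberTheory.ComplexMultiplication
open Literature.NumberTheory.NumberFields
open Summit.HodgeConjecture.Ring2WeilCoverage.LatticeNormTwist
open Summit.HodgeConjecture.Ring2WeilCoverage.CyclotomicTwistedLevel56 (nodd_fiftySix_eq classes_fiftySix)
open Summit.HodgeConjecture.Ring2WeilCoverage.CyclotomicTwistedLevelsIff (principal_iff_fiftySix)
open Summit.HodgeConjecture.Ring2WeilCoverage.CyclotomicUnitProducts (re_embedding_gen)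
open Summit.HodgeConjecture.Ring2WeilCoverage.RealQuadraticUnitNorm (complexConj_eq_inv_of_pow_eq_one)

variable {K : Type} [Field K] [NumberField K] [IsCMField K] {ζ : K}

/-- `𝐞(t) = exp(2πi t/56) ∈ ℂ` (`ZMod.toCircle`). -/
local notation3 (prettyPrint := false) "𝐞 " t:max => ((ZMod.toCircle t : Circle) : ℂ)
/-- the residue set `S_Φ` of a CM type. -/
local notation3 (prettyPrint := false) "𝐒 " Φ:max =>
  (Finset.univ.filter fun t : ZMod 56 => ∃ σ ∈ (Φ : CMType K).1, σ ζ = 𝐞 t)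
/-- `N_odd` at `56` as a filter (parts 37/41). -/
local notation3 (prettyPrint := false) "Nodd56" =>
  (Finset.univ.filter fun t : ZMod 56 => t.val.Coprime 56 ∧
    Even (Finset.card (Finset.filter (fun s : ZMod 56 => s.val.Coprime 56 ∧ s.val < t.val) Finset.univ)))
/-- `C₊ = {χ₈ = +1}` at `56`. -/
local notation3 (prettyPrint := false) "Cp56" => ({1, 9, 15, 17, 23, 25, 31, 33, 39, 41, 47, 55} : Finset (ZMod 56))
/-- the sign predicate of `α`: `56 < t mod 112 ↔ 56 < 63t mod 112`. -/
local notation3 (prettyPrint := false) "negA " t:max =>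
  (56 < 1 * ZMod.val (t : ZMod 56) % (2 * 56) ↔ 56 < 63 * ZMod.val (t : ZMod 56) % (2 * 56))
/-- `α = ζ²⁴(1 − ζ)(1 − ζ⁶³)` (written `ζ¹` for part 13's product form). -/
local notation3 (prettyPrint := false) "α" => (ζ ^ 24 * (1 - ζ ^ 1) * (1 - ζ ^ 63))
/-- the lattice `𝔓 = (1 − ζ⁷, ζ⁸ + ζ¹⁶ + ζ³²) ⊂ 𝓞 K`. -/
local notation3 (prettyPrint := false) "𝔓[" hζ "]" =>
  (Ideal.span {1 - IsPrimitiveRoot.toInteger hζ ^ 7,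
    IsPrimitiveRoot.toInteger hζ ^ 8 + IsPrimitiveRoot.toInteger hζ ^ 16 + IsPrimitiveRoot.toInteger hζ ^ 32} : Ideal (𝓞 K))

/-! ### §1 The element `α` -/

omit [NumberField K] [IsCMField K] in
/-- **`σ_t(α)` is real, non-zero, and negative iff `56 < t mod 112 ↔ 56 < 63t mod 112`** (part 13 `re_embedding_gen` with
`(a, b, h) = (1, 63, 24)`, `2h + a + b = 112`).
research route conditional on HC_CM; not a corollary; Q11.4-sentence-2 already refuted in dim ≥ 3. [cite: Washington1997, §8.1] -/
theorem alpha_read {σ : K →+* ℂ} {t : ZMod 56} (ht : t.val.Coprime 56) (hσ : σ ζ = 𝐞 t) :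
    ((σ α).re < 0 ↔ negA t) ∧ (σ α).re ≠ 0 ∧ (σ α).im = 0 :=
  re_embedding_gen (n := 56) hσ ht (by decide) (by decide) (by decide)

/-- **`α ∈ ℚ(ζ₅₆)⁺`, `α ≠ 0`.**
research route conditional on HC_CM; not a corollary; Q11.4-sentence-2 already refuted in dim ≥ 3. [folklore] -/
theorem alpha_real_ne_zero (hζ : IsPrimitiveRoot ζ 56) : IsCMField.complexConj K α = α ∧ α ≠ 0 := by
  obtain ⟨φ⟩ := (inferInstance : Nonempty (K →+* ℂ))
  obtain ⟨t, ht, hφ⟩ := exists_apply_eq_toCircle hζ φ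
  obtain ⟨-, hne, him⟩ := alpha_read ht hφ
  refine ⟨φ.injective ?_, fun h => hne (by rw [h, map_zero, Complex.zero_re])⟩
  rw [IsCMField.complexEmbedding_complexConj]
  exact Complex.ext (by rw [Complex.conj_re]) (by rw [Complex.conj_im, him, neg_zero])

omit [NumberField K] [IsCMField K] in
/-- The read in the form used by part 42: «`Re σ(α) < 0 ↔ negA t`» whenever `σ ζ = 𝐞(t)`. [folklore] -/
theorem alpha_read' : ∀ (σ : K →+* ℂ) (t : ZMod 56), t.val.Coprime 56 → σ ζ = 𝐞 t → ((σ α).re < 0 ↔ negA t) :=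
  fun _ _ ht hσ => (alpha_read ht hσ).1

/-! ### §2 The constants: `A ∩ C₊` and `A ∩ C₋` are three symmetric pairs each -/

/-- The decidable facts: on units, `t ∈ C₊ ∧ negA t ↔ t ∈ {9,15,25,31,41,47}` and `t ∉ C₊ ∧ negA t ↔ t ∈ {11,13,27,29,43,45}`;
both sets consist of units and are symmetric; `C₊` and its complement are symmetric. [folklore] -/
theorem negA_facts :
    (∀ t : ZMod 56, t.val.Coprime 56 → ((t ∈ Cp56 ∧ negA t) ↔ t ∈ ({9, 15, 25, 31, 41, 47} : Finset (ZMod 56)))) ∧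
    (∀ t : ZMod 56, t.val.Coprime 56 → ((t ∉ Cp56 ∧ negA t) ↔ t ∈ ({11, 13, 27, 29, 43, 45} : Finset (ZMod 56)))) ∧
    (∀ t ∈ ({9, 15, 25, 31, 41, 47} : Finset (ZMod 56)), t.val.Coprime 56 ∧ -t ∈ ({9, 15, 25, 31, 41, 47} : Finset (ZMod 56))) ∧
    (∀ t ∈ ({11, 13, 27, 29, 43, 45} : Finset (ZMod 56)), t.val.Coprime 56 ∧ -t ∈ ({11, 13, 27, 29, 43, 45} : Finset (ZMod 56))) ∧
    (∀ t ∈ Cp56, -t ∈ Cp56) ∧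
    (∀ t ∈ (Finset.univ.filter fun t : ZMod 56 => t ∉ Cp56), -t ∈ (Finset.univ.filter fun t : ZMod 56 => t ∉ Cp56)) := by
  refine ⟨by decide, by decide, by decide, by decide, by decide, by decide⟩

/-- **`|{t ∈ S ∩ C₊ : negA t}| = 3`** for every CM-type set `S`.
research route conditional on HC_CM; not a corollary; Q11.4-sentence-2 already refuted in dim ≥ 3. [folklore] -/
theorem card_filter_negA_plus {S : Finset (ZMod 56)} (hS : IsCMTypeSet 56 S) :
    ((S ∩ Cp56).filter fun t => negA t).card = 3 := by
  obtain ⟨h1, -, h3, -, -, -⟩ := negA_facts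
  have hset : ((S ∩ Cp56).filter fun t => negA t) = S ∩ ({9, 15, 25, 31, 41, 47} : Finset (ZMod 56)) := by
    ext t
    simp only [Finset.mem_filter, Finset.mem_inter]
    constructor
    · rintro ⟨⟨htS, htC⟩, hN⟩
      exact ⟨htS, (h1 t (hS.1 t htS)).mp ⟨htC, hN⟩⟩
    · rintro ⟨htS, htD⟩
      obtain ⟨htC, hN⟩ := (h1 t (hS.1 t htS)).mpr htD
      exact ⟨⟨htS, htC⟩, hN⟩
  have h := two_mul_card_inter_eq hS h3
  rw [hset]
  have : ({9, 15, 25, 31, 41, 47} : Finset (ZMod 56)).card = 6 := by decide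
  omega

/-- **`|{t ∈ S ∩ C₋ : negA t}| = 3`** for every CM-type set `S` (`C₋` = the complement of `C₊`).
research route conditional on HC_CM; not a corollary; Q11.4-sentence-2 already refuted in dim ≥ 3. [folklore] -/
theorem card_filter_negA_minus {S : Finset (ZMod 56)} (hS : IsCMTypeSet 56 S) :
    ((S ∩ (Finset.univ.filter fun t : ZMod 56 => t ∉ Cp56)).filter fun t => negA t).card = 3 := by
  obtain ⟨-, h2, -, h4, -, -⟩ := negA_facts
  have hset : ((S ∩ (Finset.univ.filter fun t : ZMod 56 => t ∉ Cp56)).filter fun t => negA t) =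
      S ∩ ({11, 13, 27, 29, 43, 45} : Finset (ZMod 56)) := by
    ext t
    simp only [Finset.mem_filter, Finset.mem_inter, Finset.mem_univ, true_and]
    constructor
    · rintro ⟨⟨htS, htC⟩, hN⟩
      exact ⟨htS, (h2 t (hS.1 t htS)).mp ⟨htC, hN⟩⟩
    · rintro ⟨htS, htD⟩
      obtain ⟨htC, hN⟩ := (h2 t (hS.1 t htS)).mpr htD
      exact ⟨⟨htS, htC⟩, hN⟩
  have h := two_mul_card_inter_eq hS h4
  rw [hset]
  have : ({11, 13, 27, 29, 43, 45} : Finset (ZMod 56)).card = 6 := by decide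
  omega

/-! ### §3 The flipped law for every lattice with `𝔪𝔪^ρ = (α)` -/

open scoped Classical in
/-- **THE FLIPPED LAW AT `56`.**  For any `K` with `IsCyclotomicExtension {56} ℚ K`, `[IsCMField K]`, `ζ` a primitive 56th
root of unity, ANY lattice `𝔪` with `𝔪𝔪^ρ = (α)`, `α = ζ²⁴(1 − ζ)(1 − ζ⁶³)`, and any CM type `Φ`: the principal CM torus
`ℂ^Φ/D(𝔪)` carries an `ι`-compatible PRINCIPAL polarisation **iff `|S_Φ ∩ N_odd ∩ C₊|` and `|S_Φ ∩ N_odd ∖ C₊|` are both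
ODD** — the negation, class by class, of the principal-lattice law `principal_iff_fiftySix` (both EVEN).
research route conditional on HC_CM; not a corollary; Q11.4-sentence-2 already refuted in dim ≥ 3. [cite: Shimura1998, §14.3 Prop. 5, p. 104; §14.4 Prop. 7, p. 105] -/
theorem principal_iff_odd_of_mul_conjIdeal_eq [IsCyclotomicExtension {56} ℚ K] (hζ : IsPrimitiveRoot ζ 56)
    (Φ : CMType K) (𝔪 : (FractionalIdeal (𝓞 K)⁰ K)ˣ)
    (h𝔪 : (𝔪 : FractionalIdeal (𝓞 K)⁰ K) * (CMTypeLattice.conjIdeal 𝔪 : FractionalIdeal (𝓞 K)⁰ K) =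
      spanSingleton (𝓞 K)⁰ α) :
    (∃ ζ' : K, IsCMField.complexConj K ζ' = -ζ' ∧ (∀ φ : Φ.1, 0 < (φ.1 ζ').im) ∧
        CMTypeLattice.IsOfType 𝔪 ζ' ⊤) ↔
      (Odd (((𝐒 Φ ∩ Nodd56).filter fun t => t ∈ Cp56).card) ∧
        Odd (((𝐒 Φ ∩ Nodd56).filter fun t => t ∉ Cp56).card)) := by
  classical
  obtain ⟨hreal, h0⟩ := alpha_real_ne_zero hζ
  obtain ⟨Φ', hΦ'⟩ := exists_twist Φ hreal h0
  obtain ⟨-, -, -, -, hCp, hCc⟩ := negA_facts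
  obtain ⟨-, -, -, hNoddSet, -, -, -, -, -, -⟩ := classes_fiftySix
  have hS := isCMTypeSet_residueFilter hζ Φ
  rw [exists_pos_isOfType_iff_twist Φ Φ' hreal h0 hΦ' 𝔪 h𝔪 ⊤, principal_iff_fiftySix hζ Φ']
  have e1 : ∀ Ψ : CMType K, ((𝐒 Ψ ∩ Nodd56).filter fun t => t ∈ Cp56) = 𝐒 Ψ ∩ Cp56 ∩ Nodd56 := fun Ψ => by
    ext t; simp only [mem_filter, mem_inter]; tauto
  have e2 : ∀ Ψ : CMType K, ((𝐒 Ψ ∩ Nodd56).filter fun t => t ∉ Cp56) =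
      𝐒 Ψ ∩ (Finset.univ.filter fun t : ZMod 56 => t ∉ Cp56) ∩ Nodd56 := fun Ψ => by
    ext t; simp only [mem_filter, mem_inter, mem_univ, true_and]; tauto
  rw [e1, e2, e1, e2]
  have hN' : IsCMTypeSet 56 Nodd56 := by rw [nodd_fiftySix_eq]; exact hNoddSet
  have h1 := card_twist_inter_inter_mod_two hζ Φ Φ' hreal h0 hΦ' (N := fun t => negA t) alpha_read' hCp hN'
  have h2 := card_twist_inter_inter_mod_two hζ Φ Φ' hreal h0 hΦ' (N := fun t => negA t) alpha_read' hCc hN'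
  rw [card_filter_negA_plus hS] at h1
  rw [card_filter_negA_minus hS] at h2
  rw [Nat.even_iff, Nat.even_iff, Nat.odd_iff, Nat.odd_iff]
  omega

/-! ### §4 The lattice `𝔓 = (1 − ζ⁷, ζ⁸ + ζ¹⁶ + ζ³²)`: `𝔓𝔓^ρ = (α)`, the flipped law on `ℂ^Φ/Φ(𝔓)`, and `𝔓` is not principal -/

section Lattice

/-- The cyclotomic relations at `56`: `1 + μ⁴ = 0` (`μ = ζ⁷`), `Σ_{k<7} ν^k = 0` (`ν = ζ⁸`), `ζ⁵⁶ = 1`, `ζ^ρ = ζ⁵⁵`. [folklore] -/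
theorem relations_fiftySix (hζ : IsPrimitiveRoot ζ 56) :
    1 + ζ ^ 28 = 0 ∧ 1 + ζ ^ 8 + ζ ^ 16 + ζ ^ 24 + ζ ^ 32 + ζ ^ 40 + ζ ^ 48 = 0 ∧
    ζ ^ 56 = 1 ∧ IsCMField.complexConj K ζ = ζ ^ 55 := by
  have h56 : ζ ^ 56 = 1 := hζ.pow_eq_one
  have h4 := ((hζ.pow (by norm_num) (show 56 = 7 * 8 by norm_num)).pow (by norm_num)
    (show 8 = 4 * 2 by norm_num)).eq_neg_one_of_two_right
  have hν : IsPrimitiveRoot (ζ ^ 8) 7 := hζ.pow (by norm_num) (by norm_num)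
  have hB := hν.geom_sum_eq_zero (by norm_num : 1 < 7)
  simp only [Finset.sum_range_succ, Finset.sum_range_zero, zero_add, ← pow_mul] at hB
  rw [← pow_mul] at h4
  refine ⟨by linear_combination h4, by linear_combination hB, h56, ?_⟩
  rw [complexConj_eq_inv_of_pow_eq_one (by norm_num) h56]
  exact inv_eq_of_mul_eq_one_right (by linear_combination h56)

/-- **`𝔓^ρ = (1 − ζ⁴⁹, ζ²⁴ + ζ⁴⁰ + ζ⁴⁸)`**: the image of `𝔓` under `ρ` restricted to `𝓞 K` (`ζ^ρ = ζ⁵⁵`, `ζ⁵⁶ = 1`). [folklore] -/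
theorem map_conj_span_eq (hζ : IsPrimitiveRoot ζ 56) :
    (𝔓[hζ]).map (AmbiguousClass.intAut (IsCMField.complexConj K) : 𝓞 K →+* 𝓞 K) =
      Ideal.span {1 - hζ.toInteger ^ 49, hζ.toInteger ^ 24 + hζ.toInteger ^ 40 + hζ.toInteger ^ 48} := by
  obtain ⟨-, -, hM, hc⟩ := relations_fiftySix hζ
  have hzK : algebraMap (𝓞 K) K hζ.toInteger = ζ := rfl
  have h7 : (ζ ^ 55) ^ 7 = ζ ^ 49 := by
    rw [← pow_mul]; linear_combination (ζ ^ 49 + ζ ^ 105 + ζ ^ 161 + ζ ^ 217 + ζ ^ 273 + ζ ^ 329) * hM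
  have h8 : (ζ ^ 55) ^ 8 = ζ ^ 48 := by
    rw [← pow_mul]; linear_combination (ζ ^ 48 + ζ ^ 104 + ζ ^ 160 + ζ ^ 216 + ζ ^ 272 + ζ ^ 328 + ζ ^ 384) * hM
  have h16 : (ζ ^ 55) ^ 16 = ζ ^ 40 := by
    rw [show (ζ ^ 55) ^ 16 = ((ζ ^ 55) ^ 8) ^ 2 by ring, h8, ← pow_mul]; linear_combination ζ ^ 40 * hM
  have h32 : (ζ ^ 55) ^ 32 = ζ ^ 24 := by
    rw [show (ζ ^ 55) ^ 32 = ((ζ ^ 55) ^ 16) ^ 2 by ring, h16, ← pow_mul]; linear_combination ζ ^ 24 * hM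
  have h1 : (AmbiguousClass.intAut (IsCMField.complexConj K) : 𝓞 K →+* 𝓞 K) (1 - hζ.toInteger ^ 7) =
      1 - hζ.toInteger ^ 49 := by
    apply RingOfIntegers.ext
    change IsCMField.complexConj K ((1 - hζ.toInteger ^ 7 : 𝓞 K) : K) = ((1 - hζ.toInteger ^ 49 : 𝓞 K) : K)
    push_cast
    simp only [map_sub, map_one, map_pow, hzK, hc, h7]
  have h2 : (AmbiguousClass.intAut (IsCMField.complexConj K) : 𝓞 K →+* 𝓞 K)
      (hζ.toInteger ^ 8 + hζ.toInteger ^ 16 + hζ.toInteger ^ 32) =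
      hζ.toInteger ^ 24 + hζ.toInteger ^ 40 + hζ.toInteger ^ 48 := by
    apply RingOfIntegers.ext
    change IsCMField.complexConj K ((hζ.toInteger ^ 8 + hζ.toInteger ^ 16 + hζ.toInteger ^ 32 : 𝓞 K) : K) =
      ((hζ.toInteger ^ 24 + hζ.toInteger ^ 40 + hζ.toInteger ^ 48 : 𝓞 K) : K)
    push_cast
    simp only [map_add, map_pow, hzK, hc, h8, h16, h32]
    ring
  rw [Ideal.map_span, Set.image_pair, h1, h2]

/-- **`𝔓𝔓^ρ = (α)` in `𝓞 K`**: `(1 − ζ⁷, θ)(1 − ζ⁴⁹, θ̄) = (ζ²⁴(1 − ζ)(1 − ζ⁶³))` — the four products are `α`-multiples with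
explicit quotients in `ℤ[ζ]`, and `α = −ζ²⁴(1−ζ)·(1−ζ⁷)θ̄ + ζ³¹(1−ζ)·θ(1−ζ⁴⁹)` (all `linear_combination` mod `Φ₅₆`;
certificates `g60/py/cert_np56.py`).
research route conditional on HC_CM; not a corollary; Q11.4-sentence-2 already refuted in dim ≥ 3. [folklore] -/
theorem span_mul_map_conj_eq (hζ : IsPrimitiveRoot ζ 56) :
    𝔓[hζ] * (𝔓[hζ]).map (AmbiguousClass.intAut (IsCMField.complexConj K) : 𝓞 K →+* 𝓞 K) =
      Ideal.span {hζ.toInteger ^ 24 * (1 - hζ.toInteger ^ 1) * (1 - hζ.toInteger ^ 63)} := by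
  obtain ⟨hA, hB, hM, -⟩ := relations_fiftySix hζ
  have hzK : algebraMap (𝓞 K) K hζ.toInteger = ζ := rfl
  rw [map_conj_span_eq hζ, Ideal.span_pair_mul_span_pair]
  apply le_antisymm
  · rw [Ideal.span_le]
    intro x hx
    simp only [Set.mem_insert_iff, Set.mem_singleton_iff] at hx
    rw [SetLike.mem_coe, Ideal.mem_span_singleton]
    rcases hx with rfl | rfl | rfl | rfl
    · refine ⟨1 + 2*hζ.toInteger + 2*hζ.toInteger^2 + 2*hζ.toInteger^3 - hζ.toInteger^5 - hζ.toInteger^6 -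
        hζ.toInteger^7 + hζ.toInteger^9 + hζ.toInteger^10 + hζ.toInteger^11 - hζ.toInteger^13 - hζ.toInteger^14 -
        hζ.toInteger^15 + hζ.toInteger^17 + hζ.toInteger^18 + hζ.toInteger^19 - hζ.toInteger^21 - hζ.toInteger^22 -
        hζ.toInteger^23, RingOfIntegers.ext ?_⟩
      push_cast; simp only [map_ofNat, hzK]
      linear_combination ((-2 : K) * ζ ^ 4 + (-2 : K) * ζ ^ 8 + (1 : K) * ζ ^ 11 + (-2 : K) * ζ ^ 12 + (1 : K) * ζ ^ 15 + (-2 : K) * ζ ^ 16 + (1 : K) * ζ ^ 19 + (-2 : K) * ζ ^ 20 + (1 : K) * ζ ^ 23 + (-2 : K) * ζ ^ 24 + (1 : K) * ζ ^ 27 + (1 : K) * ζ ^ 28 + (1 : K) * ζ ^ 29 + (1 : K) * ζ ^ 31 + (1 : K) * ζ ^ 32 + (-1 : K) * ζ ^ 35 + (1 : K) * ζ ^ 36 + (1 : K) * ζ ^ 37 + (1 : K) * ζ ^ 40 + (-1 : K) * ζ ^ 43 + (1 : K) * ζ ^ 44 + (1 : K) * ζ ^ 45 + (1 : K) * ζ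 ^ 48 + (-1 : K) * ζ ^ 51) * hA + ((2 : K) + (2 : K) * ζ ^ 4 + (-1 : K) * ζ ^ 7 + (-1 : K) * ζ ^ 11 + (-1 : K) * ζ ^ 24 + (-1 : K) * ζ ^ 25 + (-1 : K) * ζ ^ 28 + (1 : K) * ζ ^ 31) * hB + ((1 : K) + (1 : K) * ζ ^ 31 + (1 : K) * ζ ^ 32 + (-2 : K) * ζ ^ 35 + (-1 : K) * ζ ^ 36 + (1 : K) * ζ ^ 39 + (1 : K) * ζ ^ 40 + (-1 : K) * ζ ^ 43 + (-1 : K) * ζ ^ 44 + (1 : K) * ζ ^ 47 + (1 : K) * ζ ^ 48 + (-1 : K) * ζ ^ 51 + (-1 : K) * ζ ^ 52 + (1 : K) * ζ ^ 55) * hM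
    · refine ⟨-2 - 2*hζ.toInteger - 2*hζ.toInteger^2 - 2*hζ.toInteger^3 + hζ.toInteger^4 + hζ.toInteger^5 +
        hζ.toInteger^6 + hζ.toInteger^7 - 2*hζ.toInteger^8 - 2*hζ.toInteger^9 - 2*hζ.toInteger^10 - 2*hζ.toInteger^11 +
        hζ.toInteger^12 + hζ.toInteger^13 + hζ.toInteger^14 + hζ.toInteger^15 - hζ.toInteger^16 - hζ.toInteger^17 -
        hζ.toInteger^18 - hζ.toInteger^19 + 2*hζ.toInteger^20 + 2*hζ.toInteger^21 + 2*hζ.toInteger^22 +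
        2*hζ.toInteger^23, RingOfIntegers.ext ?_⟩
      push_cast; simp only [map_ofNat, hzK]
      linear_combination ((-3 : K) * ζ ^ 28 + (3 : K) * ζ ^ 35 + (-3 : K) * ζ ^ 36 + (3 : K) * ζ ^ 43 + (-3 : K) * ζ ^ 44 + (3 : K) * ζ ^ 51) * hA + ((3 : K) * ζ ^ 24 + (-3 : K) * ζ ^ 31) * hB + ((-2 : K) * ζ ^ 31 + (3 : K) * ζ ^ 35 + (-3 : K) * ζ ^ 39 + (3 : K) * ζ ^ 43 + (-2 : K) * ζ ^ 47 + (3 : K) * ζ ^ 51 + (-2 : K) * ζ ^ 55) * hM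
    · refine ⟨-1 - 2*hζ.toInteger - 2*hζ.toInteger^2 - 2*hζ.toInteger^3 - hζ.toInteger^4 - hζ.toInteger^8 -
        hζ.toInteger^9 - hζ.toInteger^10 - hζ.toInteger^11 + hζ.toInteger^13 + hζ.toInteger^14 + hζ.toInteger^15 +
        hζ.toInteger^20 + hζ.toInteger^21 + hζ.toInteger^22 + hζ.toInteger^23, RingOfIntegers.ext ?_⟩
      push_cast; simp only [map_ofNat, hzK]
      linear_combination ((1 : K) * ζ ^ 5 + (1 : K) * ζ ^ 9 + (-1 : K) * ζ ^ 12 + (2 : K) * ζ ^ 13 + (-1 : K) * ζ ^ 16 + (2 : K) * ζ ^ 17 + (-2 : K) * ζ ^ 20 + (2 : K) * ζ ^ 21 + (-2 : K) * ζ ^ 24 + (2 : K) * ζ ^ 25 + (-3 : K) * ζ ^ 28 + (1 : K) * ζ ^ 29 + (-2 : K) * ζ ^ 32 + (1 : K) * ζ ^ 33 + (1 : K) * ζ ^ 35 + (-2 : K) * ζ ^ 36 + (-1 : K) * ζ ^ 40 + (1 : K) * ζ ^ 43 + (-1 : K) * ζ ^ 44 + (1 : K) * ζ ^ 51) * hA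 + ((-1 : K) * ζ + (-1 : K) * ζ ^ 5 + (1 : K) * ζ ^ 8 + (-1 : K) * ζ ^ 9 + (1 : K) * ζ ^ 12 + (-1 : K) * ζ ^ 13 + (1 : K) * ζ ^ 16 + (1 : K) * ζ ^ 20 + (1 : K) * ζ ^ 24 + (-1 : K) * ζ ^ 31) * hB + ((-1 : K) * ζ + (-1 : K) * ζ ^ 9 + (-1 : K) * ζ ^ 25 + (-1 : K) * ζ ^ 31 + (-1 : K) * ζ ^ 32 + (1 : K) * ζ ^ 35 + (1 : K) * ζ ^ 36 + (-1 : K) * ζ ^ 39 + (1 : K) * ζ ^ 43 + (1 : K) * ζ ^ 44 + (-1 : K) * ζ ^ 47 + (1 : K) * ζ ^ 51 + (-1 : K) * ζ ^ 55) * hM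
    · refine ⟨3 + 4*hζ.toInteger + 4*hζ.toInteger^2 + 4*hζ.toInteger^3 - hζ.toInteger^5 - hζ.toInteger^6 -
        hζ.toInteger^7 + 2*hζ.toInteger^8 + 3*hζ.toInteger^9 + 3*hζ.toInteger^10 + 2*hζ.toInteger^11 - hζ.toInteger^12 -
        2*hζ.toInteger^13 - 2*hζ.toInteger^14 - 2*hζ.toInteger^15 + hζ.toInteger^16 + 2*hζ.toInteger^17 +
        hζ.toInteger^18 + hζ.toInteger^19 - 2*hζ.toInteger^20 - 3*hζ.toInteger^21 - 3*hζ.toInteger^22 -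
        3*hζ.toInteger^23, RingOfIntegers.ext ?_⟩
      push_cast; simp only [map_ofNat, hzK]
      linear_combination ((-3 : K) * ζ ^ 4 + (-3 : K) * ζ ^ 8 + (-4 : K) * ζ ^ 12 + (-4 : K) * ζ ^ 16 + (-5 : K) * ζ ^ 20 + (-5 : K) * ζ ^ 24 + (1 : K) * ζ ^ 29 + (-1 : K) * ζ ^ 32 + (-3 : K) * ζ ^ 35 + (1 : K) * ζ ^ 36 + (1 : K) * ζ ^ 37 + (-3 : K) * ζ ^ 43 + (2 : K) * ζ ^ 44 + (1 : K) * ζ ^ 45 + (1 : K) * ζ ^ 48 + (-3 : K) * ζ ^ 51) * hA + ((3 : K) + (3 : K) * ζ ^ 4 + (1 : K) * ζ ^ 8 + (1 : K) * ζ ^ 12 + (1 : K) * ζ ^ 16 + (1 : K) * ζ ^ 20 + (-2 : K) * ζ ^ 24 + (-1 : K) * ζ ^ 25 + (-1 : K) * ζ ^ 28 + (3 : K) * ζ ^ 31) * hB + ((3 : K) + (1 : K) * ζ ^ 8 + (1 : K) * ζ ^ 16 + (1 : K) * ζ ^ 24 + (3 : K) * ζ ^ 31 + (1 : K) * ζ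 ^ 32 + (-4 : K) * ζ ^ 35 + (-1 : K) * ζ ^ 36 + (3 : K) * ζ ^ 39 + (1 : K) * ζ ^ 40 + (-1 : K) * ζ ^ 42 + (-3 : K) * ζ ^ 43 + (-1 : K) * ζ ^ 44 + (3 : K) * ζ ^ 47 + (1 : K) * ζ ^ 48 + (-1 : K) * ζ ^ 49 + (-3 : K) * ζ ^ 51 + (-1 : K) * ζ ^ 52 + (3 : K) * ζ ^ 55) * hM
  · rw [Ideal.span_singleton_le_iff_mem]
    have heq : hζ.toInteger ^ 24 * (1 - hζ.toInteger ^ 1) * (1 - hζ.toInteger ^ 63) =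
        (-(hζ.toInteger ^ 24 * (1 - hζ.toInteger))) *
            ((1 - hζ.toInteger ^ 7) * (hζ.toInteger ^ 24 + hζ.toInteger ^ 40 + hζ.toInteger ^ 48)) +
          (hζ.toInteger ^ 31 * (1 - hζ.toInteger)) *
            ((hζ.toInteger ^ 8 + hζ.toInteger ^ 16 + hζ.toInteger ^ 32) * (1 - hζ.toInteger ^ 49)) := by
      apply RingOfIntegers.ext
      push_cast; simp only [hzK]
      linear_combination ((-2 : K) * ζ ^ 4 + (1 : K) * ζ ^ 5 + (-2 : K) * ζ ^ 8 + (1 : K) * ζ ^ 9 + (1 : K) * ζ ^ 11 + (-4 : K) * ζ ^ 12 + (2 : K) * ζ ^ 13 + (1 : K) * ζ ^ 15 + (-4 : K) * ζ ^ 16 + (2 : K) * ζ ^ 17 + (2 : K) * ζ ^ 19 + (-6 : K) * ζ ^ 20 + (3 : K) * ζ ^ 21 + (2 : K) * ζ ^ 23 + (-6 : K) * ζ ^ 24 + (3 : K) * ζ ^ 25 + (3 : K) * ζ ^ 27 + (-6 : K) * ζ ^ 28 + (3 : K) * ζ ^ 29 + (3 : K) * ζ ^ 31 + (-4 : K) *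 ζ ^ 32 + (2 : K) * ζ ^ 33 + (3 : K) * ζ ^ 35 + (-4 : K) * ζ ^ 36 + (2 : K) * ζ ^ 37 + (2 : K) * ζ ^ 39 + (-2 : K) * ζ ^ 40 + (1 : K) * ζ ^ 41 + (2 : K) * ζ ^ 43 + (-2 : K) * ζ ^ 44 + (1 : K) * ζ ^ 45 + (1 : K) * ζ ^ 47 + (1 : K) * ζ ^ 51) * hA + ((2 : K) + (-1 : K) * ζ + (2 : K) * ζ ^ 4 + (-1 : K) * ζ ^ 5 + (-1 : K) * ζ ^ 7 + (2 : K) * ζ ^ 8 + (-1 : K) * ζ ^ 9 + (-1 : K) * ζ ^ 11 + (2 : K) * ζ ^ 12 + (-1 : K) * ζ ^ 13 + (-1 : K) * ζ ^ 15 + (2 : K) * ζ ^ 16 + (-1 : K) * ζ ^ 17 + (-1 : K) * ζ ^ 19 + (2 : K) * ζ ^ 20 + (-1 : K) * ζ ^ 21 + (-1 : K) * ζ ^ 23 + (2 : K) * ζ ^ 24 + (-1 : K) * ζ ^ 25 + (-1 : K) * ζ ^ 27 + (-1 : K) * ζ ^ 31) * hB + ((2 : K) + (-1 : K) * ζ +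 (-1 : K) * ζ ^ 7 + (2 : K) * ζ ^ 8 + (-1 : K) * ζ ^ 9 + (-1 : K) * ζ ^ 15 + (2 : K) * ζ ^ 16 + (-1 : K) * ζ ^ 17 + (-1 : K) * ζ ^ 23 + (1 : K) * ζ ^ 24 + (-1 : K) * ζ ^ 31 + (2 : K) * ζ ^ 32 + (-1 : K) * ζ ^ 33 + (1 : K) * ζ ^ 40 + (-1 : K) * ζ ^ 41 + (1 : K) * ζ ^ 56 + (-1 : K) * ζ ^ 57) * hM
    rw [heq]
    exact Ideal.add_mem _ (Ideal.mul_mem_left _ _ (Ideal.subset_span (by simp)))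
      (Ideal.mul_mem_left _ _ (Ideal.subset_span (by simp)))

/-- **`𝔓𝔓^ρ = (α)` as fractional ideals**: for any invertible `𝔪` with `𝔪 = 𝔓` (as a fractional ideal), `𝔪𝔪^ρ = (α)`. [folklore] -/
theorem mul_conjIdeal_eq_of_coe_eq (hζ : IsPrimitiveRoot ζ 56) (𝔪 : (FractionalIdeal (𝓞 K)⁰ K)ˣ)
    (h : (𝔪 : FractionalIdeal (𝓞 K)⁰ K) = ((𝔓[hζ] : Ideal (𝓞 K)) : FractionalIdeal (𝓞 K)⁰ K)) :
    (𝔪 : FractionalIdeal (𝓞 K)⁰ K) * (CMTypeLattice.conjIdeal 𝔪 : FractionalIdeal (𝓞 K)⁰ K) = spanSingleton (𝓞 K)⁰ α := by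
  rw [CMTypeLattice.coe_conjIdeal, h, AmbiguousClass.fracIdealAut, AmbiguousClass.ringEquivOfRingEquiv_coeIdeal,
    ← coeIdeal_mul, span_mul_map_conj_eq hζ, coeIdeal_span_singleton]
  rfl

/-- **`𝔓` is an invertible lattice**: some `𝔪 : (FractionalIdeal (𝓞 K)⁰ K)ˣ` has `𝔪 = 𝔓` (`𝔓𝔓^ρ ∋ α ≠ 0`). [folklore] -/
theorem exists_units_coe_eq (hζ : IsPrimitiveRoot ζ 56) :
    ∃ 𝔪 : (FractionalIdeal (𝓞 K)⁰ K)ˣ, (𝔪 : FractionalIdeal (𝓞 K)⁰ K) = ((𝔓[hζ] : Ideal (𝓞 K)) : FractionalIdeal (𝓞 K)⁰ K) := by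
  have hne : (𝔓[hζ] : Ideal (𝓞 K)) ≠ ⊥ := by
    intro hbot
    have h := span_mul_map_conj_eq hζ
    rw [hbot, Ideal.bot_mul, eq_comm, Ideal.span_singleton_eq_bot] at h
    have h' := congrArg (fun x : 𝓞 K => (x : K)) h
    have hzK : algebraMap (𝓞 K) K hζ.toInteger = ζ := rfl
    push_cast at h'
    simp only [hzK] at h'
    exact (alpha_real_ne_zero hζ).2 h'
  exact ⟨Units.mk0 _ (coeIdeal_ne_zero.mpr hne), rfl⟩

open scoped Classical in
/-- **THE NON-PRINCIPAL LATTICE CLASS AT `56`, DECIDED**: for every CM type `Φ`, `ℂ^Φ/Φ(𝔓)` (`𝔓 = (1 − ζ⁷, ζ⁸ + ζ¹⁶ + ζ³²)`)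
carries an `ι`-compatible principal polarisation **iff `|S_Φ ∩ N_odd ∩ C₊|` and `|S_Φ ∩ N_odd ∖ C₊|` are both ODD**.
research route conditional on HC_CM; not a corollary; Q11.4-sentence-2 already refuted in dim ≥ 3. [cite: Shimura1998, §14.3 Prop. 5, p. 104; §14.4 Prop. 7, p. 105] -/
theorem principal_iff_odd_fiftySix_nonprincipal [IsCyclotomicExtension {56} ℚ K] (hζ : IsPrimitiveRoot ζ 56) (Φ : CMType K)
    (𝔪 : (FractionalIdeal (𝓞 K)⁰ K)ˣ)
    (h : (𝔪 : FractionalIdeal (𝓞 K)⁰ K) = ((𝔓[hζ] : Ideal (𝓞 K)) : FractionalIdeal (𝓞 K)⁰ K)) :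
    (∃ ζ' : K, IsCMField.complexConj K ζ' = -ζ' ∧ (∀ φ : Φ.1, 0 < (φ.1 ζ').im) ∧
        CMTypeLattice.IsOfType 𝔪 ζ' ⊤) ↔
      (Odd (((𝐒 Φ ∩ Nodd56).filter fun t => t ∈ Cp56).card) ∧
        Odd (((𝐒 Φ ∩ Nodd56).filter fun t => t ∉ Cp56).card)) :=
  principal_iff_odd_of_mul_conjIdeal_eq hζ Φ 𝔪 (mul_conjIdeal_eq_of_coe_eq hζ 𝔪 h)

open scoped Classical in
/-- **`𝔓 = (1 − ζ⁷, ζ⁸ + ζ¹⁶ + ζ³²)` is NOT a principal ideal of `𝓞 ℚ(ζ₅₆)`.**  If `𝔓 = (g)`, a principal lattice repeats the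
verdict of `ℤ[ζ₅₆]` (part 42 §4); at the CM type `Φ₀` with `S_{Φ₀} = N_odd` both twisted counts are `6`: principally
polarisable on `ℤ[ζ₅₆]` (part 41), not on `𝔓` (§4) — contradiction.  (Signature proof of `h(ℚ(ζ₅₆)) > 1`.)
research route conditional on HC_CM; not a corollary; Q11.4-sentence-2 already refuted in dim ≥ 3. [cite: Washington1997, tables §11] -/
theorem not_isPrincipal_fiftySix [IsCyclotomicExtension {56} ℚ K] (hζ : IsPrimitiveRoot ζ 56) : ¬ (𝔓[hζ] : Ideal (𝓞 K)).IsPrincipal := by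
  classical
  rintro ⟨g, hg⟩
  obtain ⟨𝔪, h𝔪⟩ := exists_units_coe_eq hζ
  have hg' : (𝔪 : FractionalIdeal (𝓞 K)⁰ K) = spanSingleton (𝓞 K)⁰ (g : K) := by
    rw [h𝔪, show (𝔓[hζ] : Ideal (𝓞 K)) = Ideal.span {g} from hg, coeIdeal_span_singleton]
  have hg0 : (g : K) ≠ 0 := by
    intro h0
    have : (𝔪 : FractionalIdeal (𝓞 K)⁰ K) = 0 := by rw [hg', h0, spanSingleton_zero]
    exact Units.ne_zero 𝔪 this
  obtain ⟨-, -, -, hNoddSet, -, -, -, -, -, -⟩ := classes_fiftySix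
  obtain ⟨Φ₀, hΦ₀⟩ := exists_cmType_iff_mem (K := K) hζ hNoddSet
  have hS0 : 𝐒 Φ₀ = ({1, 5, 11, 15, 19, 25, 29, 33, 39, 43, 47, 53} : Finset (ZMod 56)) := by
    ext t
    simp only [mem_filter, mem_univ, true_and]
    constructor
    · rintro ⟨σ, hσ, hσt⟩
      obtain ⟨t', ht', hσt'⟩ := (hΦ₀ σ).mp hσ
      rwa [ZMod.injective_toCircle (Circle.ext (hσt.symm.trans hσt'))]
    · intro ht
      obtain ⟨σ, hσ⟩ := exists_embedding_apply_eq_toCircle hζ t (hNoddSet.1 t ht)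
      exact ⟨σ, (hΦ₀ σ).mpr ⟨t, ht, hσ⟩, hσ⟩
  have h1 := (exists_pos_isOfType_iff_of_eq_spanSingleton Φ₀ 𝔪 hg0 hg' ⊤).mpr
    ((principal_iff_fiftySix hζ Φ₀).mpr (by rw [hS0, nodd_fiftySix_eq]; decide))
  have h2 := (principal_iff_odd_fiftySix_nonprincipal hζ Φ₀ 𝔪 h𝔪).mp h1
  rw [hS0, nodd_fiftySix_eq] at h2
  revert h2
  decide

/-! ### §5 Every CM type with counts of equal parity is principally polarisable on `ℤ[ζ₅₆]` or on `𝔓` -/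

open scoped Classical in
/-- **EVERY CM TYPE WHOSE TWO TWISTED COUNTS HAVE THE SAME PARITY IS THE TYPE OF A PRINCIPALLY POLARISED SIMPLE CM ABELIAN
VARIETY WITH CM BY `ℤ[ζ₅₆]`** — on the principal lattice if both counts are even (part 41), on `𝔓` if both are odd (§4).  All
`K`-balanced types of the census rows at `56` have counts of equal parity (b01.39 (D)): the NO classes there are NO on
`ℤ[ζ₅₆]` and YES on `𝔓`.
research route conditional on HC_CM; not a corollary; Q11.4-sentence-2 already refuted in dim ≥ 3. [cite: Shimura1998, §14.3 Prop. 4–5, pp. 103–104] -/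
theorem exists_principal_on_some_lattice_fiftySix [IsCyclotomicExtension {56} ℚ K] (hζ : IsPrimitiveRoot ζ 56) (Φ : CMType K)
    (hpar : ((𝐒 Φ ∩ Nodd56).filter fun t => t ∈ Cp56).card % 2 = ((𝐒 Φ ∩ Nodd56).filter fun t => t ∉ Cp56).card % 2) :
    ∃ 𝔪 : (FractionalIdeal (𝓞 K)⁰ K)ˣ,
      ((𝔪 : FractionalIdeal (𝓞 K)⁰ K) = 1 ∨
        (𝔪 : FractionalIdeal (𝓞 K)⁰ K) = ((𝔓[hζ] : Ideal (𝓞 K)) : FractionalIdeal (𝓞 K)⁰ K)) ∧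
      ∃ ζ' : K, IsCMField.complexConj K ζ' = -ζ' ∧ (∀ φ : Φ.1, 0 < (φ.1 ζ').im) ∧ CMTypeLattice.IsOfType 𝔪 ζ' ⊤ := by
  rcases Nat.even_or_odd (((𝐒 Φ ∩ Nodd56).filter fun t => t ∈ Cp56).card) with he | ho
  · refine ⟨1, Or.inl rfl, (principal_iff_fiftySix hζ Φ).mpr ⟨he, Nat.even_iff.mpr ?_⟩⟩
    have := Nat.even_iff.mp he; omega
  · obtain ⟨𝔪, h𝔪⟩ := exists_units_coe_eq hζ
    refine ⟨𝔪, Or.inr h𝔪, (principal_iff_odd_fiftySix_nonprincipal hζ Φ 𝔪 h𝔪).mpr ⟨ho, Nat.odd_iff.mpr ?_⟩⟩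
    have := Nat.odd_iff.mp ho; omega

end Lattice

end Summit.HodgeConjecture.Ring2WeilCoverage.NonPrincipalLatticeLevel56

end
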